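import Literature.AlgebraicGeometry.HodgeTheory.RealSl2BlocksTimesGenericInvariance
import Literature.AlgebraicGeometry.HodgeTheory.TypeIIMinimalPowersHodgeClasses
import Literature.AlgebraicGeometry.Motives.HodgeThetaAnnihilatorSymplecticTimesAnisotropic
import HarnessLib

/-!
# Hodge classes on abelian varieties with slots over `A × C`, `A` a rank-two carrier of real `𝔰𝔩₂`-block data (a non-CM elliptic curve) and `C` a simple abelian surface with `dim_ℚ End⁰(C) = 4` (quaternionic multiplication): the invariance theorem — the coefficient tensor is killed by `𝔰𝔩(V)` at the `A`-places (Hazama 1989 / Moonen–Zarhin 1999 Thm. (3.2)(1), Lie step, for `E × S` with `S` of Type II(1))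

Family `hodge`, layer `Literature/AlgebraicGeometry/HodgeTheory`. Research context: cell `pub-hodge-ring2`
(HONEST FRAMING: research route conditional on HC_CM; not a corollary; Q11.4-sentence-2 already refuted in
dim ≥ 3), Literature lane, programme R16 («`E × S(II(1))`»: a non-CM elliptic curve times a simple abelian surface
with quaternionic multiplication — the last threefold row of Moonen–Zarhin's Thm. 0.1 (4) the tree lacked, after
R14 did `E × S` for `End⁰(S) = ℚ` and R4 did the CM factors). UNCONDITIONAL (`hHD`, `hI` are the tree theorems
`exists_isReal_hodgeModel_holds`, `hodgePQ_independent_of_hodgeModel_holds`, kept as arguments as in the whole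
Betti universe); theorems only, no named fact; no step towards a summit statement. This file is the CLONE of
`RealSl2BlocksTimesGenericInvariance` (programme R14) with the generic second factor replaced by a simple abelian
surface `C` with `dim_ℚ End⁰(C) = 4` and the SIZE hypothesis replaced by the inputs of the anisotropic Lie step
`HodgeStructure.wordDerAt_incl₁_eq_zero_of_symplectic_times_anisotropic`
(`Motives/HodgeThetaAnnihilatorSymplecticTimesAnisotropic`): Moonen–Zarhin's graph `Γ_φ` of (3.1) cannot be
excluded by size here (`dim hg(E) = 3 = dim hg(S)` for `S` of Type II(1)); it is excluded because `hg(E) = 𝔰𝔩_{2,ℚ}`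
contains a split pair `h e − e h = 2e` while every non-zero element of the commutant of `End⁰(S)` in
`End_ℚ(H¹ S)` is invertible (`H¹(S; ℚ)` is free of rank one over the division algebra `End⁰(S)`).

PRINTED RESULT. Moonen–Zarhin, Math. Ann. 315 (1999), Thm. (3.2)(1) (= Hazama, Duke Math. J. 58 (1989);
Gordon's survey Thm. 7.6.2): «Let `X₁` and `X₂` be complex abelian varieties which both satisfy condition (D).
(1) Suppose `X₁` and `X₂` contain no factors of Type 4. Then `X₁ × X₂` again satisfies (D), and either
`Hom(X₁, X₂) ≠ 0` or `Hg(X₁ × X₂) = Hg(X₁) × Hg(X₂)`» [corpus: paper:arxiv-math_9901113 p. 6], together with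
(2.2) «Type 2(1): `D = End⁰(X)` is a quaternion algebra over `ℚ`, split at `∞` … Then `Hg(X)` is the algebraic
group `U_{D^opp}`» [ibid. p. 5]. This file is the LIE STEP of that statement on tensors, for `X₁ = A` a carrier
of real `𝔰𝔩₂`-block data of RANK TWO (`dim_ℚ H¹(A) = 2`, `End_Hdg(H¹ A) = ℚ`: a non-CM elliptic curve, `Hg = SL₂`)
and `X₂ = C` simple of dimension `2` with `dim_ℚ End⁰(C) = 4` (`Hom(A, C) = 0`).

MAIN RESULT `AVSlots.exists_coeff_killed_at_real_places_of_prod_isSimple_endRankFour`: the statement of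
`AVSlots.exists_coeff_killed_at_real_places_of_prod_endRankOne` VERBATIM (a Hodge-adapted pair basis
`(c_i^0, c_i^1)` of `H¹(C) ⊗ ℂ`; every rational `(p,p)`-class on `X` with slots over `A × C` is `∑_w a(w) · (letters)_w`
with `a(U, −)` killed by every trace-free `N` placed at the positions of each `A`-place `τ`), with the hypotheses on
the factors replaced as above — so that the evaluation pipeline of programme R14 (`RealSl2BlocksTimesGenericProducts`)
runs with the quaternionic surface in place of the generic factor (file `RealSl2BlocksTimesQuaternionProducts`).

PROOF = R14's proof with the inputs of the abstract Lie step supplied as follows. For `H¹(A)`: (RIGID) the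
`Θ`-subalgebra theorem `ThetaSubalgebra.mem_spanC_iff_mapsTo_and_skew` with the single real block `= H¹(A) ⊗ ℂ`
(rank two) and `End_Hdg = ℚ`; (IDEAL) `SymplecticIdeal.theta_mem_of_ne_bot_hodge`; (SPLIT)
`exists_skew_pair_commutator_eq_two_smul` for the alternating polarization; three independent
`ψ_ℂ`-skew operators `ψ(e_i,·)e_j + ψ(e_j,·)e_i` (`linearIndependent_pairOp_basis`, `card_pairs_le 1 = 3`). For
`H¹(C)`: `θ = bettiRep C` maps the division ring `End⁰(C)` (`C` simple, Mumford §19 Cor. 2) into `End_Hdg(H¹ C)`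
with `dim_ℚ End⁰(C) = 4 = dim_ℚ H¹(C)`, so (ANISO) `AntiRep.eq_zero_or_isUnit_of_forall_commute` and
(FEW) `AntiRep.finrank_lt_of_forall_commute_of_skew` (`< 4`, i.e. `≤ 3`).

## References

* [MoonenZarhin1999LowDim] B. Moonen, Yu. Zarhin, Math. Ann. 315 (1999), §2 (2.2), §3 (3.1) and Thm. (3.2)(1),
  Thm. 0.1 (4) [corpus: paper:arxiv-math_9901113 p. 1, 5–6]. [cite: MoonenZarhin1999LowDim, §3 Thm. (3.2)(1)]
* [Hazama1989] F. Hazama, *Algebraic cycles on nonsimple abelian varieties*, Duke Math. J. 58 (1989) 31–37.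
  [cite: Hazama1989, Thm. (= Gordon 7.6.2)]
* [Gordon1999HodgeAVSurvey] B. B. Gordon, *A survey of the Hodge conjecture for abelian varieties*, Thm. 7.6.2
  [corpus: paper:arxiv-alg-geom_9709030 p. 21]. [cite: Gordon1999HodgeAVSurvey, Thm. 7.6.2]
* [Hazama1983] F. Hazama, Tôhoku Math. J. 35 (1983), Thm. (1.1), §3 pp. 305–306. [cite: Hazama1983, §3 (pp. 305–306)]
* [Ribet1983] K. A. Ribet, Amer. J. Math. 105 (1983), Thm. 0–1. [cite: Ribet1983, Thm. 0–1]
* [MumfordAV1970] D. Mumford, *Abelian Varieties* (1970), §19 Cor. 2 of Thm. 1 (p. 174). [cite: MumfordAV1970, §19 Cor. 2 of Thm. 1 (p. 174)]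
* [Deligne1982HodgeCycles] P. Deligne, LNM 900 (1982), I §3 Prop. 3.4, §4 p. 30. [cite: Deligne1982HodgeCycles, I §3 Prop. 3.4]
* [VoisinHodgeI2002] C. Voisin, *Hodge Theory I*, §7.1.1, §7.3.2, §11.3.3 Thm. 11.38. [cite: VoisinHodgeI2002, §7.3.2]
* [GoodmanWallachGTM255] R. Goodman, N. R. Wallach, GTM 255, §2.1.2, §4.1.1. [cite: GoodmanWallachGTM255, §2.1.2]
-/

noncomputable section

open scoped TensorProduct
open CategoryTheory Module

namespace Literature.AlgebraicGeometry.HodgeTheory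

open Literature.AlgebraicTopology.SingularHomology
open Literature.AlgebraicGeometry.Motives (IsSmoothProjective AbelianVariety bettiCohomology
  ofRatClassBaseChange ofRatClassBaseChange_tmul HodgeTensorFacts hodgeTensorFacts_holds)
open Literature.Barriers.HodgeConjecture
open Literature.AlgebraicGeometry.Motives.HodgeStructure
open Literature.AlgebraicGeometry.ComplexMultiplication
open Literature.RepresentationTheory.GeneralLinear
open Literature.NumberTheory.DiophantineGeometry

/-! ### The invariance theorem for slots over `A × C`, `A` of rank two with `End_Hdg = ℚ`, `C` a simple surface with `dim_ℚ End⁰(C) = 4` -/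

section RankTwo

universe u

variable {V : Type u} [AddCommGroup V] [Module ℚ V] [Module.Finite ℚ V] {m : ℤ}

/-- **(RIGID) in rank two: every admissible rational Lie algebra of a rank-two carrier of real `𝔰𝔩₂`-block data
with `End_Hdg = ℚ` complexifies to all of `𝔰𝔭(V ⊗ ℂ) = 𝔰𝔩₂(ℂ)`** — the `Θ`-subalgebra theorem
`ThetaSubalgebra.mem_spanC_iff_mapsTo_and_skew` with the single block `= V ⊗ ℂ` (every operator preserves it) and
the commutant condition automatic (`End_Hdg(V) = ℚ · 1`). For `V = H¹` of a non-CM elliptic curve: `hg(E) = 𝔰𝔩₂`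
(Moonen–Zarhin (2.1)). [cite: MoonenZarhin1999LowDim, §2 (2.1)] [cite: Hazama1983, Thm. (1.1) and §3 (pp. 305–306)] -/
theorem mem_spanC_of_skew_of_rankTwo (H : Motives.HodgeStructure V m) (hm : Odd m) (ψ : H.Polarization)
    (hself : ∀ a : H.endAlg, LinearMap.IsAdjointPair ψ.form ψ.form (a : Module.End ℚ V) (a : Module.End ℚ V))
    {T : Type*} [Fintype T] [DecidableEq T] (σ : T → (H.endAlg →+* ℂ)) (hreal : ∀ τ, (starRingEnd ℂ).comp (σ τ) = σ τ)
    (hint : DirectSum.IsInternal fun τ => H.eigenBlock (σ τ)) (h2 : ∀ τ, Module.finrank ℂ (H.eigenBlock (σ τ)) = 2)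
    (hV : Module.finrank ℚ V = 2) (hE : ∀ a ∈ H.endAlg, ∃ x : ℚ, a = x • 1)
    (𝔤 : Submodule ℚ (Module.End ℚ V)) (hbr : ∀ X ∈ 𝔤, ∀ X' ∈ 𝔤, X * X' - X' * X ∈ 𝔤)
    {Θ : Module.End ℂ (ℂ ⊗[ℚ] V)} (hΘ : ∀ p, ∀ x ∈ H.piece p (m - p), Θ x = ((2 * p - m : ℤ) : ℂ) • x)
    (hΘ𝔤 : Θ ∈ spanC 𝔤) (hskew : ∀ X ∈ 𝔤, ∀ v w, ψ.form (X v) w + ψ.form v (X w) = 0)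
    {Y : Module.End ℂ (ℂ ⊗[ℚ] V)} (hY : ∀ x y, ψ.form.baseChange ℂ (Y x) y + ψ.form.baseChange ℂ x (Y y) = 0) :
    Y ∈ spanC 𝔤 := by
  have hblockTop : ∀ τ, H.eigenBlock (σ τ) = ⊤ := fun τ =>
    Submodule.eq_top_of_finrank_eq (by rw [h2 τ, Module.finrank_baseChange, hV])
  have hcomm : ∀ X ∈ 𝔤, ∀ a : H.endAlg, X * (a : Module.End ℚ V) = (a : Module.End ℚ V) * X := by
    intro X _ a
    obtain ⟨x, hx⟩ := hE (a : Module.End ℚ V) a.2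
    rw [hx, mul_smul_comm, smul_mul_assoc, mul_one, one_mul]
  exact (ThetaSubalgebra.mem_spanC_iff_mapsTo_and_skew H hm ψ hself σ hreal hint h2 𝔤 hbr hΘ hΘ𝔤 hcomm hskew Y).2
    ⟨fun τ => by rw [hblockTop τ]; exact fun x _ => Submodule.mem_top, hY⟩

/-- **Three independent `ψ_ℂ`-skew operators on a rank-two `V ⊗ ℂ`** (`dim 𝔰𝔭₂ = dim 𝔰𝔩₂ = 3`): the symmetrised
operators `ψ(e_i, ·) e_j + ψ(e_j, ·) e_i`, `i ≤ j < 2`, of a basis (`linearIndependent_pairOp_basis`,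
`card_pairs_le 1`). [cite: GoodmanWallachGTM255, §2.1.2] [cite: MoonenZarhin1999LowDim, §2 (2.1)] -/
theorem exists_three_skew_linearIndependent_of_rankTwo (H : Motives.HodgeStructure V m) (hm : Odd m)
    (ψ : H.Polarization) (hV : Module.finrank ℚ V = 2) :
    ∃ Z : Fin 3 → Module.End ℂ (ℂ ⊗[ℚ] V), LinearIndependent ℂ Z ∧
      ∀ i x y, ψ.form.baseChange ℂ (Z i x) y + ψ.form.baseChange ℂ x (Z i y) = 0 := by
  classical
  have hV' : Module.finrank ℚ V = 2 * 1 := by rw [hV]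
  set e : Module.Basis (Fin (2 * 1)) ℂ (ℂ ⊗[ℚ] V) :=
    (Algebra.TensorProduct.basis ℂ (Module.finBasis ℚ V)).reindex (finCongr hV') with he
  have hωalt : ∀ x y, ψ.form.baseChange ℂ x y = -ψ.form.baseChange ℂ y x := fun x y => by
    rw [ψ.form_baseChange_swap y x, Int.negOnePow_odd _ hm]; norm_num
  set P : {p : Fin (2 * 1) × Fin (2 * 1) // p.1 ≤ p.2} → Module.End ℂ (ℂ ⊗[ℚ] V) :=
    fun p => (ψ.form.baseChange ℂ (e p.1.1)).smulRight (e p.1.2) +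
      (ψ.form.baseChange ℂ (e p.1.2)).smulRight (e p.1.1) with hPdef
  have hPind : LinearIndependent ℂ P := linearIndependent_pairOp_basis _ ψ.nondegenerate_baseChange e
  have hcard : Fintype.card {p : Fin (2 * 1) × Fin (2 * 1) // p.1 ≤ p.2} = 3 := by
    rw [card_pairs_le 1]
  set σJ : Fin 3 ≃ {p : Fin (2 * 1) × Fin (2 * 1) // p.1 ≤ p.2} := (Fintype.equivFinOfCardEq hcard).symm with hσJ
  refine ⟨P ∘ σJ, hPind.comp _ σJ.injective, fun i x y => ?_⟩
  rw [Function.comp_apply, hPdef]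
  exact SymplecticIdeal.pairOp_skew _ hωalt (e (σJ i).1.1) (e (σJ i).1.2) x y

end RankTwo

section Invariance

variable {A C X : AbelianVariety ℂ} {n : ℕ} {g : Fin n → (X ⟶ A.prod C)}

/-- The two elements of `Fin 2`. [folklore] -/
private theorem fin2_eq_zero_or_one₄ (r : Fin 2) : r = 0 ∨ r = 1 := by
  fin_cases r <;> simp

open scoped Classical in
/-- **The INVARIANCE THEOREM for slots over `A × C`, `A` a rank-two carrier of real `𝔰𝔩₂`-block data with
`End_Hdg(H¹ A) = ℚ` (a non-CM elliptic curve), `C` a simple abelian surface with `dim_ℚ End⁰(C) = 4` (Hazama 1989 /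
Moonen–Zarhin 1999 Thm. (3.2)(1), Lie step; Hazama 1983 §3).** Let `ψ` be a polarization of `H¹(A(ℂ); ℚ)` with
`End_Hdg` self-adjoint, `σ_τ` (`τ ∈ T`) REAL characters of `End_Hdg(H¹(A))` whose two-dimensional eigenblocks
`V_τ` decompose `H¹(A) ⊗ ℂ`, `b_τ` Hodge-adapted block bases, with `dim_ℚ H¹(A) = 2` and every Hodge endomorphism of
`H¹(A)` a rational scalar; let `C` be SIMPLE with `dim C = 2` and `dim_ℚ End⁰(C) = 4` (so `End⁰(C)` is a division
algebra with `H¹(C; ℚ)` free of rank one over it: ANISOTROPY replaces R14's SIZE in excluding Moonen–Zarhin's graph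
`Γ_φ` — `Hom(A, C) = 0`), and let `X` be an abelian variety with slots `g` over `A × C`. Then there is a
Hodge-adapted pair basis `(c_i^0, c_i^1)_{i < h}` of `H¹(C) ⊗ ℂ` (`c_i^0 ∈ H^{1,0}`, `c_i^1 ∈ H^{0,1}`) such that
every rational class `c` of type `(p,p)` on `X` (`p ≥ 1`) is `∑_w a(w) · x_w` in the letters
`x((j, inl τ), r) = g_j^* pr_A^* b_τ^r`, `x((j, inr i), r) = g_j^* pr_C^* c_i^r`, for a coefficient function `a`
such that for every slot-and-place word `U`, every `A`-place `τ` and every trace-free `N ∈ M₂(ℂ)` the operator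
`N` placed at the positions of place `inl τ` kills the slice `a(U, −)`: the tensor invariants of `X` are
invariants of `𝔰𝔩(V) ⊕ 0 ⊆ Lie Hg(A) ⊕ Lie Hg(C)` («`Hg(X₁ × X₂) = Hg(X₁) × Hg(X₂)`»).
[cite: MoonenZarhin1999LowDim, §3 Thm. (3.2)(1)] [cite: Hazama1989, Thm. (= Gordon 7.6.2)]
[cite: Hazama1983, Thm. (1.1) and §3 (pp. 305–306)] [cite: MumfordAV1970, §19 Cor. 2 of Thm. 1 (p. 174)] -/
theorem AVSlots.exists_coeff_killed_at_real_places_of_prod_isSimple_endRankFour [HodgeTensorFacts.{0, 0}]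
    (hg : AVSlots (A.prod C) X g)
    (hHD : exists_isReal_hodgeModel) (hI : hodgePQ_independent_of_hodgeModel)
    {T : Type} [Fintype T] [DecidableEq T]
    (ψ : (BettiUniverse.hodge hHD (AbelianVariety.isSmoothProjective_holds (A := A)) 1).Polarization)
    (hself : ∀ a : (BettiUniverse.hodge hHD (AbelianVariety.isSmoothProjective_holds (A := A)) 1).endAlg,
      LinearMap.IsAdjointPair ψ.form ψ.form (a : Module.End ℚ (bettiCohomology A.X 1))
        (a : Module.End ℚ (bettiCohomology A.X 1)))
    (σ : T → ((BettiUniverse.hodge hHD (AbelianVariety.isSmoothProjective_holds (A := A)) 1).endAlg →+* ℂ))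
    (hreal : ∀ τ, (starRingEnd ℂ).comp (σ τ) = σ τ)
    (hint : DirectSum.IsInternal fun τ =>
      (BettiUniverse.hodge hHD (AbelianVariety.isSmoothProjective_holds (A := A)) 1).eigenBlock (σ τ))
    (h2 : ∀ τ, Module.finrank ℂ
      ((BettiUniverse.hodge hHD (AbelianVariety.isSmoothProjective_holds (A := A)) 1).eigenBlock (σ τ)) = 2)
    (b : ∀ τ, Module.Basis (Fin 2) ℂ
      ((BettiUniverse.hodge hHD (AbelianVariety.isSmoothProjective_holds (A := A)) 1).eigenBlock (σ τ)))
    (hb0 : ∀ τ, (b τ 0 : ℂ ⊗[ℚ] bettiCohomology A.X 1) ∈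
      (BettiUniverse.hodge hHD (AbelianVariety.isSmoothProjective_holds (A := A)) 1).piece 1 0)
    (hb1 : ∀ τ, (b τ 1 : ℂ ⊗[ℚ] bettiCohomology A.X 1) ∈
      (BettiUniverse.hodge hHD (AbelianVariety.isSmoothProjective_holds (A := A)) 1).piece 0 1)
    (hV₁ : Module.finrank ℚ (bettiCohomology A.X 1) = 2)
    (hAend : ∀ a ∈ (BettiUniverse.hodge hHD (AbelianVariety.isSmoothProjective_holds (A := A)) 1).endAlg,
      ∃ x : ℚ, a = x • 1)
    (hS : C.IsSimple) (hCend : Module.finrank ℚ C.endAlgebra = 4) (hCdim : C.dim = 2) :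
    ∃ (h : ℕ) (cC : Module.Basis (Fin h × Fin 2) ℂ (ℂ ⊗[ℚ] bettiCohomology C.X 1)),
      (∀ i, cC (i, 0) ∈ (BettiUniverse.hodge hHD (AbelianVariety.isSmoothProjective_holds (A := C)) 1).piece 1 0) ∧
      (∀ i, cC (i, 1) ∈ (BettiUniverse.hodge hHD (AbelianVariety.isSmoothProjective_holds (A := C)) 1).piece 0 1) ∧
      ∀ {p : ℕ}, 0 < p → ∀ {c : complexBetti X.X (2 * p)}, IsRationalClass c →
        IsOfHodgeType X.dim X.X (2 * p) p p c →
        ∃ a : (Fin (2 * p) → (Fin n × (T ⊕ Fin h)) × Fin 2) → ℂ,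
          wordEval (cupPowOneAlt ℂ (Motives.ComplexPoints X.X) (2 * p))
            (fun jr : (Fin n × (T ⊕ Fin h)) × Fin 2 => complexBetti.map (g jr.1.1).hom.hom.hom 1
              (Sum.elim
                (fun τ => complexBetti.map (Motives.AbelianVariety.fst A C).hom.hom.hom 1
                  (ofRatClassBaseChange (Motives.ComplexPoints A.X) 1 (b τ jr.2 : ℂ ⊗[ℚ] bettiCohomology A.X 1)))
                (fun i => complexBetti.map (Motives.AbelianVariety.snd A C).hom.hom.hom 1
                  (ofRatClassBaseChange (Motives.ComplexPoints C.X) 1 (cC (i, jr.2))))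
                jr.1.2)) a = c ∧
          ∀ (U : Fin (2 * p) → Fin n × (T ⊕ Fin h)) (τ : T) (N : Matrix (Fin 2) (Fin 2) ℂ), N.trace = 0 →
            wordDerAt ℂ (colourOp ℂ (fun t => (U t).2) (Sum.inl τ) N) (wordSlice a U) = 0 := by
  classical
  -- the setting
  have hXA : IsSmoothProjective A.dim A.X := AbelianVariety.isSmoothProjective_holds
  have hXC : IsSmoothProjective C.dim C.X := AbelianVariety.isSmoothProjective_holds
  have hXP : IsSmoothProjective (A.prod C).dim (A.prod C).X := AbelianVariety.isSmoothProjective_holds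
  haveI : Module.Finite ℚ (bettiCohomology A.X 1) := finite_bettiCohomology_one A
  haveI : Module.Finite ℚ (bettiCohomology C.X 1) := finite_bettiCohomology_one C
  haveI : Module.Finite ℚ (bettiCohomology (A.prod C).X 1) := finite_bettiCohomology_one (A.prod C)
  have hodd : Odd (((1 : ℕ) : ℤ)) := ⟨0, by norm_num⟩
  -- §2: the pair basis of `H¹(C) ⊗ ℂ`
  obtain ⟨h, cC, hcC0, hcC1⟩ := exists_hodgeAdapted_pairBasis (BettiUniverse.hodge hHD hXC 1) (by norm_num)
    (BettiUniverse.hodge_isEffective hHD hXC 1)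
  have hcC0' : ∀ i, cC (i, 0) ∈ (BettiUniverse.hodge hHD hXC 1).piece 1 0 := fun i => by simpa using hcC0 i
  have hcC1' : ∀ i, cC (i, 1) ∈ (BettiUniverse.hodge hHD hXC 1).piece 0 1 := fun i => by simpa using hcC1 i
  refine ⟨h, cC, hcC0', hcC1', ?_⟩
  intro p hp c hcQ hc
  -- the presentation `H¹(A × C) = pr_A^* H¹(A) ⊕ pr_C^* H¹(C)` and its complexification
  set ι₁ := HOneProduct.pullFst A C with hι₁
  set π₁ := HOneProduct.pullInl A C with hπ₁
  set ι₂ := HOneProduct.pullSnd A C with hι₂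
  set π₂ := HOneProduct.pullInr A C with hπ₂
  have hπι₁ : π₁ ∘ₗ ι₁ = LinearMap.id := HOneProduct.pullInl_comp_pullFst
  have hπι₂ : π₂ ∘ₗ ι₂ = LinearMap.id := HOneProduct.pullInr_comp_pullSnd
  have hπ₁ι₂ : π₁ ∘ₗ ι₂ = 0 := HOneProduct.pullInl_comp_pullSnd
  have hπ₂ι₁ : π₂ ∘ₗ ι₁ = 0 := HOneProduct.pullInr_comp_pullFst
  have hsum : ι₁ ∘ₗ π₁ + ι₂ ∘ₗ π₂ = LinearMap.id := HOneProduct.pullFst_comp_pullInl_add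
  have hπι₁C : π₁.baseChange ℂ ∘ₗ ι₁.baseChange ℂ = LinearMap.id := by
    rw [← LinearMap.baseChange_comp, hπι₁, LinearMap.baseChange_id]
  have hπι₂C : π₂.baseChange ℂ ∘ₗ ι₂.baseChange ℂ = LinearMap.id := by
    rw [← LinearMap.baseChange_comp, hπι₂, LinearMap.baseChange_id]
  have hπ₁ι₂C : π₁.baseChange ℂ ∘ₗ ι₂.baseChange ℂ = 0 := by
    rw [← LinearMap.baseChange_comp, hπ₁ι₂, LinearMap.baseChange_zero]
  have hπ₂ι₁C : π₂.baseChange ℂ ∘ₗ ι₁.baseChange ℂ = 0 := by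
    rw [← LinearMap.baseChange_comp, hπ₂ι₁, LinearMap.baseChange_zero]
  have hsumC : ι₁.baseChange ℂ ∘ₗ π₁.baseChange ℂ + ι₂.baseChange ℂ ∘ₗ π₂.baseChange ℂ = LinearMap.id := by
    rw [← LinearMap.baseChange_comp, ← LinearMap.baseChange_comp, ← LinearMap.baseChange_add, hsum,
      LinearMap.baseChange_id]
  -- piece compatibility of `pr_A^*`, `pr_C^*` (pull-backs are morphisms of Hodge structures)
  have hι₁F : ∀ q : ℤ, ∀ x ∈ (BettiUniverse.hodge hHD hXA 1).piece q (((1 : ℕ) : ℤ) - q), ι₁.baseChange ℂ x ∈ (BettiUniverse.hodge hHD hXP 1).piece q (((1 : ℕ) : ℤ) - q) :=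
    fun q x hx => (BettiUniverse.pullHodgeHom hHD hI hXP hXA (Motives.AbelianVariety.fst A C).hom.hom.hom 1).map_piece_le
      q _ ⟨x, hx, rfl⟩
  have hι₂F : ∀ q : ℤ, ∀ x ∈ (BettiUniverse.hodge hHD hXC 1).piece q (((1 : ℕ) : ℤ) - q), ι₂.baseChange ℂ x ∈ (BettiUniverse.hodge hHD hXP 1).piece q (((1 : ℕ) : ℤ) - q) :=
    fun q x hx => (BettiUniverse.pullHodgeHom hHD hI hXP hXC (Motives.AbelianVariety.snd A C).hom.hom.hom 1).map_piece_le
      q _ ⟨x, hx, rfl⟩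
  -- §1: the basis `cbU` of `H¹(A × C) ⊗ ℂ` in blocks: `pr_A^* b_τ^r` and `pr_C^* c_i^r`
  set cbA : Module.Basis (T × Fin 2) ℂ (ℂ ⊗[ℚ] bettiCohomology A.X 1) :=
    (hint.collectedBasis b).reindex (Equiv.sigmaEquivProd T (Fin 2)) with hcbA
  have hcbA_apply : ∀ τr : T × Fin 2, (cbA τr : ℂ ⊗[ℚ] bettiCohomology A.X 1) = b τr.1 τr.2 := by
    rintro ⟨τ, r⟩
    simp [cbA, DirectSum.IsInternal.collectedBasis_coe, Equiv.sigmaEquivProd]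
  obtain ⟨cbx', hcbx'l, hcbx'r⟩ := exists_basis_of_presentation hπι₁C hπι₂C hπ₁ι₂C hπ₂ι₁C hsumC cbA cC
  set cbx : Module.Basis ((T ⊕ Fin h) × Fin 2) ℂ (ℂ ⊗[ℚ] bettiCohomology (A.prod C).X 1) :=
    cbx'.reindex (Equiv.sumProdDistrib T (Fin h) (Fin 2)).symm with hcbxdef
  have hcbx : ∀ tr : (T ⊕ Fin h) × Fin 2, cbx tr =
      Sum.elim (fun τ => ι₁.baseChange ℂ (b τ tr.2 : ℂ ⊗[ℚ] bettiCohomology A.X 1))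
        (fun i => ι₂.baseChange ℂ (cC (i, tr.2))) tr.1 := by
    rintro ⟨t, r⟩
    rw [hcbxdef, Module.Basis.reindex_apply, Equiv.symm_symm]
    rcases t with τ | i
    · rw [Equiv.sumProdDistrib_apply_left, hcbx'l, hcbA_apply]; rfl
    · rw [Equiv.sumProdDistrib_apply_right, hcbx'r]; rfl
  -- Hodge-adaptedness of `cbx`
  have hcbx0 : ∀ t, cbx (t, 0) ∈ (BettiUniverse.hodge hHD hXP 1).piece 1 0 := by
    intro t
    rw [hcbx]
    rcases t with τ | i
    · exact hι₁F 1 _ (by simpa using hb0 τ)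
    · exact hι₂F 1 _ (by simpa using hcC0' i)
  have hcbx1 : ∀ t, cbx (t, 1) ∈ (BettiUniverse.hodge hHD hXP 1).piece 0 1 := by
    intro t
    rw [hcbx]
    rcases t with τ | i
    · have e : (((1 : ℕ) : ℤ) - 0) = 1 := by norm_num
      have h01 := hι₁F 0 _ (by rw [e]; exact hb1 τ)
      rwa [e] at h01
    · have e : (((1 : ℕ) : ℤ) - 0) = 1 := by norm_num
      have h01 := hι₂F 0 _ (by rw [e]; exact hcC1' i)
      rwa [e] at h01
  -- bases indexed by `Fin M`: the block basis `cbσ` and the rational basis `eC`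
  set eQ := Module.finBasis ℚ (bettiCohomology (A.prod C).X 1) with heQ
  set eC : Module.Basis (Fin (Module.finrank ℚ (bettiCohomology (A.prod C).X 1))) ℂ
    (ℂ ⊗[ℚ] bettiCohomology (A.prod C).X 1) := Algebra.TensorProduct.basis ℂ eQ with heC
  set φ : Fin (Module.finrank ℚ (bettiCohomology (A.prod C).X 1)) ≃ (T ⊕ Fin h) × Fin 2 :=
    eC.indexEquiv cbx with hφ
  set cbσ : Module.Basis (Fin (Module.finrank ℚ (bettiCohomology (A.prod C).X 1))) ℂ
    (ℂ ⊗[ℚ] bettiCohomology (A.prod C).X 1) := cbx.reindex φ.symm with hcbσdef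
  have hcbσ : ∀ m, cbσ m = cbx (φ m) := fun m => by
    rw [hcbσdef, Module.Basis.reindex_apply, Equiv.symm_symm]
  -- letters
  set ρ := ofRatClassBaseChangeEquiv hXP 1 with hρ
  set v : Module.Basis _ ℂ (complexBetti (A.prod C).X 1) := cbσ.map ρ with hv
  set eL : Module.Basis _ ℂ (complexBetti (A.prod C).X 1) := eC.map ρ with heL
  have heLQ : ∀ i, IsRationalClass (eL i) := fun i => by
    rw [heL, Module.Basis.map_apply, heC, Algebra.TensorProduct.basis_apply, hρ,
      ofRatClassBaseChangeEquiv_apply, ofRatClassBaseChange_tmul, one_smul]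
    exact isRationalClass_ofRatClass _
  set κ : Fin (Module.finrank ℚ (bettiCohomology (A.prod C).X 1)) → Fin 2 := fun m => (φ m).2 with hκ
  have hv_apply : ∀ m, v m = ofRatClassBaseChange (Motives.ComplexPoints (A.prod C).X) 1 (cbx (φ m)) := fun m => by
    rw [hv, Module.Basis.map_apply, hcbσ, hρ, ofRatClassBaseChangeEquiv_apply]
  have hv0 : ∀ m, κ m = 0 → IsOfHodgeType (A.prod C).dim (A.prod C).X 1 1 0 (v m) := by
    intro m hm
    rw [hv_apply, ← BettiUniverse.mem_hodge_piece_iff hHD hI hXP (k := 1) (p := 1) (q := 0) rfl]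
    have hsplit : φ m = ((φ m).1, 0) := by
      change (φ m).2 = 0 at hm; rw [← hm]
    rw [hsplit]
    exact hcbx0 _
  have hv1 : ∀ m, κ m = 1 → IsOfHodgeType (A.prod C).dim (A.prod C).X 1 0 1 (v m) := by
    intro m hm
    rw [hv_apply, ← BettiUniverse.mem_hodge_piece_iff hHD hI hXP (k := 1) (p := 0) (q := 1) rfl]
    have hsplit : φ m = ((φ m).1, 1) := by
      change (φ m).2 = 1 at hm; rw [← hm]
    rw [hsplit]
    exact hcbx1 _
  -- (α) an antisymmetric kind-balanced coefficient function in the adapted letters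
  obtain ⟨ax, hax_bal, hax_anti, hcax⟩ := hg.exists_antisymm_kindBalanced_wordEval_eq v κ hv0 hv1 hp hc
  -- the change of letters to the rational letters
  set G : Matrix _ _ ℂ := eC.toMatrix cbσ with hG
  set G' : Matrix _ _ ℂ := cbσ.toMatrix eC with hG'
  have hG'G : G' * G = 1 := cbσ.toMatrix_mul_toMatrix_flip eC
  have hve : ∀ m, v m = ∑ i, G i m • eL i := fun m => by
    simp only [hv, heL, Module.Basis.map_apply, ← map_smul, ← map_sum]
    congr 1
    exact (eC.sum_toMatrix_smul_self (v := ⇑cbσ) (j := m)).symm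
  have hletters : ∀ j m, avLetters g v (j, m) = ∑ i, G i m • avLetters g eL (j, i) :=
    avLetters_baseChange g G hve
  set aE := colourChangeAt (fun _ : Fin n => G) ax with haE
  have haE_anti : IsAntisymm aE := hax_anti.colourChangeAt _
  have hcaE : wordEval (cupPowOneAlt ℂ (Motives.ComplexPoints X.X) (2 * p)) (avLetters g eL) aE = c := by
    rw [haE, ← wordEval_eq_wordEval_colourChangeAt _ (fun _ : Fin n => G) hletters ax, hcax]
  -- rationality of `aE`
  have hFinj : Function.Injective (exteriorPower.alternatingMapLinearEquiv
      (cupPowOneAlt ℂ (Motives.ComplexPoints X.X) (2 * p))) :=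
    injective_alternatingMapLinearEquiv_cupPowOneAlt X (2 * p)
  obtain ⟨q, hq⟩ := hg.exists_rat_wordEval_eq eL heLQ hcQ
  obtain ⟨q', -, haEq⟩ := haE_anti.exists_eq_algebraMap_of_wordEval_eq hFinj (hg.letterBasis eL)
    (q := q) (by rw [AVSlots.coe_letterBasis, hcaE, hq])
  have hslice_e : ∀ u, wordSlice aE u = wordRepAt ℂ (fun _ : Fin (2 * p) => G) (wordSlice ax u) :=
    fun u => wordSlice_colourChangeAt (fun _ : Fin n => G) ax u
  -- the Hodge operator `Θ` of `H¹(A × C)`: `diag(±1)` in the adapted letters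
  obtain ⟨Θ, hΘ⟩ := exists_hodgeTheta (BettiUniverse.hodge hHD hXP 1)
  have hΘb : ∀ m, Θ (cbσ m) = (if κ m = 0 then (1 : ℂ) else -1) • cbσ m := by
    intro m
    rw [hcbσ]
    change Θ _ = (if (φ m).2 = 0 then (1 : ℂ) else -1) • _
    rcases fin2_eq_zero_or_one₄ (φ m).2 with h0 | h1
    · rw [h0, if_pos rfl]
      have hmem : cbx (φ m) ∈ (BettiUniverse.hodge hHD hXP 1).piece 1 (((1 : ℕ) : ℤ) - 1) := by
        have e : (((1 : ℕ) : ℤ) - 1) = 0 := by norm_num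
        have hsplit : φ m = ((φ m).1, 0) := by rw [← h0]
        rw [e, hsplit]; exact hcbx0 _
      rw [hΘ 1 _ hmem]
      norm_num
    · rw [h1, if_neg one_ne_zero]
      have hmem : cbx (φ m) ∈ (BettiUniverse.hodge hHD hXP 1).piece 0 (((1 : ℕ) : ℤ) - 0) := by
        have e : (((1 : ℕ) : ℤ) - 0) = 1 := by norm_num
        have hsplit : φ m = ((φ m).1, 1) := by rw [← h1]
        rw [e, hsplit]; exact hcbx1 _
      rw [hΘ 0 _ hmem]
      norm_num
  have hΘcb : LinearMap.toMatrix cbσ cbσ Θ = kindDiag κ := by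
    ext i m
    rw [LinearMap.toMatrix_apply, hΘb, map_smul, Module.Basis.repr_self, Finsupp.smul_apply,
      Finsupp.single_apply, kindDiag, Matrix.diagonal_apply, smul_eq_mul, mul_ite, mul_one, mul_zero]
    by_cases him : i = m
    · subst him; rw [if_pos rfl]
    · rw [if_neg (Ne.symm him), if_neg him]
  have hJG : LinearMap.toMatrix eC eC Θ * G = G * kindDiag κ := by
    rw [← hΘcb, hG, linearMap_toMatrix_mul_basis_toMatrix, basis_toMatrix_mul_linearMap_toMatrix]
  have hΘq : ∀ u : Fin (2 * p) → Fin n, wordDerAt ℂ (fun _ : Fin (2 * p) => LinearMap.toMatrix eC eC Θ)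
      (wordSlice (fun w => algebraMap ℚ ℂ (q' w)) u) = 0 := by
    intro u
    rw [← haEq, hslice_e]
    refine wordDerAt_wordRepAt_eq_zero_of_mul_eq ℂ (fun _ : Fin (2 * p) => G) (fun _ => hJG) ?_
    rw [wordDerAt_const]
    exact wordDer_kindDiag_wordSlice_eq_zero κ hax_bal u
  -- the rigid split factor `A` (rank two): (RIGID), (IDEAL), (SPLIT), three independent skew operators
  have heffA := BettiUniverse.hodge_isEffective hHD hXA 1
  obtain ⟨Θ₁, hΘ₁⟩ := exists_hodgeTheta (BettiUniverse.hodge hHD hXA 1)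
  have h1 : (((1 : ℕ) : ℤ)) = 1 := Nat.cast_one
  have hrigid : ∀ 𝔤₁ : Submodule ℚ (Module.End ℚ (bettiCohomology A.X 1)),
      (∀ X ∈ 𝔤₁, ∀ X' ∈ 𝔤₁, X * X' - X' * X ∈ 𝔤₁) →
      (∀ X ∈ 𝔤₁, ∀ v w, ψ.form (X v) w + ψ.form v (X w) = 0) → Θ₁ ∈ spanC 𝔤₁ →
      ∀ Y : Module.End ℂ (ℂ ⊗[ℚ] bettiCohomology A.X 1),
        (∀ x y, ψ.form.baseChange ℂ (Y x) y + ψ.form.baseChange ℂ x (Y y) = 0) → Y ∈ spanC 𝔤₁ :=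
    fun 𝔤₁ hbr hskew hΘ𝔤 Y hY => mem_spanC_of_skew_of_rankTwo (BettiUniverse.hodge hHD hXA 1) hodd ψ hself σ hreal
      hint h2 hV₁ hAend 𝔤₁ hbr hΘ₁ hΘ𝔤 hskew hY
  have hideal : ∀ I : Submodule ℂ (Module.End ℂ (ℂ ⊗[ℚ] bettiCohomology A.X 1)),
      (∀ Y ∈ I, ∀ x y, ψ.form.baseChange ℂ (Y x) y + ψ.form.baseChange ℂ x (Y y) = 0) →
      (∀ Zc : Module.End ℂ (ℂ ⊗[ℚ] bettiCohomology A.X 1),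
        (∀ x y, ψ.form.baseChange ℂ (Zc x) y + ψ.form.baseChange ℂ x (Zc y) = 0) →
          ∀ Y ∈ I, Zc * Y - Y * Zc ∈ I) → I ≠ ⊥ → Θ₁ ∈ I :=
    fun I hIskew hIst hI0 => SymplecticIdeal.theta_mem_of_ne_bot_hodge _ h1 heffA ψ hΘ₁ I hIskew hIst hI0
  haveI : Nontrivial (bettiCohomology A.X 1) := Module.nontrivial_of_finrank_pos (R := ℚ) (by rw [hV₁]; norm_num)
  have hψalt : ∀ x y, ψ.form x y = -ψ.form y x := fun x y => by
    rw [ψ.form_swap y x, Int.negOnePow_odd _ hodd]; norm_num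
  obtain ⟨e, h', he0, heskew, hhskew, hhe⟩ := exists_skew_pair_commutator_eq_two_smul ψ.form ψ.nondegenerate hψalt
  obtain ⟨Z, hZind, hZskew⟩ :=
    exists_three_skew_linearIndependent_of_rankTwo (BettiUniverse.hodge hHD hXA 1) hodd ψ hV₁
  -- the anisotropic factor `C`: polarization, Hodge operator, (ANISO), (FEW)
  obtain ⟨ψC⟩ : (BettiUniverse.hodge hHD hXC 1).IsPolarizable :=
    smoothProjective_hodgeStructure_isPolarizable_holds hXC (BettiUniverse.realHodgeModel hHD hXC)
      (BettiUniverse.realHodgeModel_isHodgeSymmetric hHD hXC) 1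
  obtain ⟨Θ₂, hΘ₂⟩ := exists_hodgeTheta (BettiUniverse.hodge hHD hXC 1)
  have hV₂ : Module.finrank ℚ (bettiCohomology C.X 1) = 2 * C.dim := finrank_bettiCohomology_one C
  haveI : Nontrivial (bettiCohomology C.X 1) :=
    Module.nontrivial_of_finrank_pos (R := ℚ) (by rw [hV₂, hCdim]; norm_num)
  have hdiv : ∀ z : C.endAlgebra, IsUnit z ∨ z = 0 := isUnit_or_eq_zero_of_isSimple hS
  have hdeg : Module.finrank ℚ C.endAlgebra = Module.finrank ℚ (bettiCohomology C.X 1) := by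
    rw [hCend, hV₂, hCdim]
  have hρ : ∀ z : C.endAlgebra, MulOpposite.unop (bettiRep C z) ∈ (BettiUniverse.hodge hHD hXC 1).endAlg :=
    unop_bettiRep_mem_endAlg hHD hI
  have haniso : ∀ X : Module.End ℚ (bettiCohomology C.X 1),
      (∀ a : (BettiUniverse.hodge hHD hXC 1).endAlg,
        X * (a : Module.End ℚ (bettiCohomology C.X 1)) = (a : Module.End ℚ (bettiCohomology C.X 1)) * X) →
      X = 0 ∨ IsUnit X :=
    fun X hX => AntiRep.eq_zero_or_isUnit_of_forall_commute (bettiRep C) hdiv hdeg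
      fun z => hX ⟨_, hρ z⟩
  have hψC0 : ψC.form ≠ 0 := by
    intro h0
    obtain ⟨v, hv⟩ := exists_ne (0 : bettiCohomology C.X 1)
    exact hv (ψC.nondegenerate.1 v fun w => by rw [h0]; rfl)
  have hdim' : ∀ 𝔤₂ : Submodule ℚ (Module.End ℚ (bettiCohomology C.X 1)),
      (∀ Y ∈ 𝔤₂, ∀ a : (BettiUniverse.hodge hHD hXC 1).endAlg,
        Y * (a : Module.End ℚ (bettiCohomology C.X 1)) = (a : Module.End ℚ (bettiCohomology C.X 1)) * Y) →
      (∀ Y ∈ 𝔤₂, ∀ v w, ψC.form (Y v) w + ψC.form v (Y w) = 0) →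
      Module.finrank ℚ 𝔤₂ ≤ 3 := by
    intro 𝔤₂ hcomm hskew
    have hlt := AntiRep.finrank_lt_of_forall_commute_of_skew (bettiRep C) hdiv hdeg ψC.form hψC0 𝔤₂
      (fun X hX z => hcomm X hX ⟨_, hρ z⟩) hskew
    rw [hV₂, hCdim] at hlt
    omega
  -- the coefficient function, refined to slot-and-place colours
  refine ⟨placeRefine φ ax, ?_, fun U τ N hN => ?_⟩
  · rw [← hcax]
    have hx : (fun jr : (Fin n × (T ⊕ Fin h)) × Fin 2 => avLetters g v (jr.1.1, φ.symm (jr.1.2, jr.2))) =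
        fun jr : (Fin n × (T ⊕ Fin h)) × Fin 2 => complexBetti.map (g jr.1.1).hom.hom.hom 1
          (Sum.elim
            (fun τ => complexBetti.map (Motives.AbelianVariety.fst A C).hom.hom.hom 1
              (ofRatClassBaseChange (Motives.ComplexPoints A.X) 1 (b τ jr.2 : ℂ ⊗[ℚ] bettiCohomology A.X 1)))
            (fun i => complexBetti.map (Motives.AbelianVariety.snd A C).hom.hom.hom 1
              (ofRatClassBaseChange (Motives.ComplexPoints C.X) 1 (cC (i, jr.2))))
            jr.1.2) := by
      funext jr
      rw [avLetters_apply, hv_apply, Equiv.apply_symm_apply, hcbx]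
      obtain ⟨⟨j, t⟩, r⟩ := jr
      rcases t with τ | i
      · simp only [Sum.elim_inl]
        congr 1
        rw [hι₁, ← ofRatClassBaseChangeEquiv_apply (hX := hXP), ← ofRatClassBaseChangeEquiv_apply (hX := hXA),
          complexBetti_map_ofRatClassBaseChangeEquiv hXP hXA]
      · simp only [Sum.elim_inr]
        congr 1
        rw [hι₂, ← ofRatClassBaseChangeEquiv_apply (hX := hXP), ← ofRatClassBaseChangeEquiv_apply (hX := hXC),
          complexBetti_map_ofRatClassBaseChangeEquiv hXP hXC]
    rw [← hx]
    exact wordEval_placeRefine _ φ (avLetters g v) ax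
  · refine wordDerAt_colourOp_placeRefine_eq_zero φ (Sum.inl τ) N (fun u => ?_) U
    -- the product Lie step (Goursat form) for `Y := pr_A^* ∘ (0 ⊕ N ⊕ 0 at place τ) ∘ ι_A^*`
    set Y := ι₁.baseChange ℂ ∘ₗ RealPlaces.assemble hint b (Pi.single τ N) ∘ₗ π₁.baseChange ℂ with hY
    have htr : ∀ τ', ((Pi.single τ N : T → Matrix (Fin 2) (Fin 2) ℂ) τ').trace = 0 := by
      intro τ'
      rw [Pi.single_apply]
      split_ifs
      · exact hN
      · exact Matrix.trace_zero _ _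
    have hL := wordDerAt_incl₁_eq_zero_of_symplectic_times_anisotropic (BettiUniverse.hodge hHD hXP 1)
      (BettiUniverse.hodge hHD hXA 1) (BettiUniverse.hodge hHD hXC 1) hπι₁ hπι₂ hπ₁ι₂ hπ₂ι₁ hsum hι₁F hι₂F ψ ψC
      hΘ₁ hΘ₂ hrigid hideal e h' he0 heskew hhskew hhe Z hZind hZskew haniso hdim' eQ q' hΘ hΘq
      (formBaseChange_assemble_add_eq_zero (BettiUniverse.hodge hHD hXA 1) hodd ψ hself σ hint b
        (Pi.single τ N) htr) u
    rw [← haEq, hslice_e] at hL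
    have hYG : ∀ _t : Fin (2 * p), LinearMap.toMatrix eC eC Y * G = G * LinearMap.toMatrix cbσ cbσ Y :=
      fun _ => by rw [hG, linearMap_toMatrix_mul_basis_toMatrix, basis_toMatrix_mul_linearMap_toMatrix]
    -- the matrix of `Y` in the block letters: `N` at the places `(j, inl τ)`, `0` elsewhere
    have e11 : ∀ x, π₁.baseChange ℂ (ι₁.baseChange ℂ x) = x := fun x => by
      rw [← LinearMap.comp_apply (f := π₁.baseChange ℂ), hπι₁C, LinearMap.id_apply]
    have e12 : ∀ y, π₁.baseChange ℂ (ι₂.baseChange ℂ y) = 0 := fun y => by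
      rw [← LinearMap.comp_apply (f := π₁.baseChange ℂ), hπ₁ι₂C, LinearMap.zero_apply]
    have hblk : LinearMap.toMatrix cbσ cbσ Y = blockLift φ (Pi.single (Sum.inl τ) N) := by
      refine toMatrix_eq_blockLift_of_apply_basis φ cbσ _ Y fun m => ?_
      rw [hcbσ m]
      have hb' : ∀ a, cbσ (φ.symm ((φ m).1, a)) = cbx ((φ m).1, a) := fun a => by
        rw [hcbσ, Equiv.apply_symm_apply]
      simp only [hb']
      obtain ⟨t, r⟩ := φ m
      rcases t with τ' | i
      · simp only [hcbx, Sum.elim_inl]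
        rw [hY, LinearMap.comp_apply, LinearMap.comp_apply, e11,
          RealPlaces.assemble_apply_basis, map_sum]
        refine Finset.sum_congr rfl fun a _ => ?_
        rw [map_smul, Pi.single_apply, Pi.single_apply]
        by_cases hτ : τ' = τ
        · subst hτ; simp
        · simp [hτ]
      · simp only [hcbx, Sum.elim_inr]
        rw [hY, LinearMap.comp_apply, LinearMap.comp_apply, e12, map_zero, map_zero]
        symm
        refine Finset.sum_eq_zero fun a _ => ?_
        rw [Pi.single_eq_of_ne (Sum.inr_ne_inl), Matrix.zero_apply, zero_smul]
    have h3 : wordRepAt ℂ (fun _ : Fin (2 * p) => G)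
        (wordDerAt ℂ (fun _ : Fin (2 * p) => blockLift φ (Pi.single (Sum.inl τ) N)) (wordSlice ax u)) = 0 := by
      rw [← hblk, wordRepAt_wordDerAt_of_mul_eq ℂ (fun _ : Fin (2 * p) => G) hYG, hL]
    exact wordRepAt_injective ℂ (g := fun _ : Fin (2 * p) => G) (g' := fun _ : Fin (2 * p) => G')
      (funext fun _ => hG'G) (by rw [h3, map_zero])

end Invariance

end Literature.AlgebraicGeometry.HodgeTheory

end
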